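/-
Copyright (c) 2026 the pub-hodgecm-mathlib formalisation cell (harness21).  Prover seat hodgecm-mathlib-K2E4-p18 (g4), Track B «K2-LIT» ∕ h413
(stmt-HodgeConjecture-24833), ‹S› ROAD J ∕ R3 «RANK-ONE MASS», letter D: the PLACE-GENERIC dock block model (non-norm in algebraic currency), cut at K2E3-p03 (g3)'s
(J3d-w) census request 2026-09-04T02:33:44Z («an `hξnn`-input twin»).  2026-09-04.
-/
import Summits.HodgeConjecture.HodgeConjecture.Theorems.K2E3DockBlockModelRamified     -- ★ p856806 (this seat): §1 rescaling algebra, §2 `exists_rescale_of_conjLocal_eq`, (D-a-ram); brings ★ F3a and the dock currency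
import HarnessLib

/-!
# ‹S› road J ∕ R3, letter D — the dock block model from a GLOBAL NON-NORM `ξ₀` in algebraic currency (any non-split place: inert, tame or WILD ramified)
# (Rogawski 1990 §4.8 Case (a) p. 53, §8.1 p. 116, §3.5 Prop. 3.5.2 (a) p. 29)

Cell `pub/hodgecm-mathlib`, Track B «K2-LIT», crux H413 = `stmt-HodgeConjecture-24833`; ‹S› ROAD J, letter ‹J3› v2 `sig_K2E3CompatibleMeasureEPIdentityRankOne`, payer road R3
«RANK-ONE MASS» (owner K2E3-p15 (g3)); residue classes (J3r) (K2E3-p17 (g4)) and (J3d-w) (K2E3-p03 (g3)).  THEOREMS ONLY (no definition, no instance, no notation, no `sorry`);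
lane `--supports stmt-HodgeConjecture-24833 --as helper`.

WHY THIS FILE.  ★ (D-a) `K2E3DockBlockModelInert.exists_blockModel_dock` (K2E4-p07, inert: `hunr`) and ★ (D-a-ram) `K2E3DockBlockModelRamified.exists_blockModel_dock_ramified` (this
seat, tame ramified: `|ξ₀|_w = 1`, `|σ_w(u)u − ξ₀|_w = 1`) both run ONE place-generic argument whose only local input is a global `ξ₀ ∈ L⁺` representing the non-trivial class of
`(L ⊗ L⁺_v)^{σ, ×} ∕ N` (order two at every non-split `v`, ★ `exists_norm_mul_of_not_exists_norm`).  At a WILD place (`2 ∈ v`) the valuation clause `hξN` is unsatisfiable (every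
residue is a square), so K2E3-p03 (g3)'s (J3d-w) road asked for the twin with the non-norm hypothesis in the ALGEBRAIC currency
`hξnn : ¬ ∃ z, IsUnit z ∧ ι(ξ₀) = (c ⊗ 1)(z)·z` — this file: **`exists_blockModel_dock_of_not_norm`**, binders = (D-a-ram)'s with `(hξ1) (hξN) ↦ (hξ0 : ξ₀ ≠ 0) (hξnn)`, output
byte-identical (`c₂, c₁ ∈ {1, ξ₀}`, `T, hT, x, hau, hx, hxε, hinter`).  §1 `exists_rescale_of_not_norm` is ★ §2 `exists_rescale_of_conjLocal_eq` with the same trade.  The proof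
body is (D-a-ram)'s token for token (★ F3a `exists_formCongr_dock_eq`; `λ, μ` units; rescaling `M = ι(s₂·1₂, s₁)·W`; ★ §1 identities of `K2E3DockBlockModelRamified`).

HONEST LABEL: HC_CM is proved only modulo the 7 printed citations (2 remaining named inputs: hLiu418 = `stmt-HodgeConjecture-24832`, h413 = `stmt-HodgeConjecture-24833`) until
rung 0 closes; count-neutral helper (local linear algebra + local class field theory); ‹J3› is NOT proved here.

## References
* [Rogawski1990] J. D. Rogawski, *Automorphic Representations of Unitary Groups in Three Variables*, Ann. of Math. Stud. 123 (1990), §4.8 Case (a) p. 53, §8.1 p. 116,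
  §3.5 Prop. 3.5.2 (a) p. 29.
* [PlatonovRapinchuk1994] V. Platonov, A. Rapinchuk, *Algebraic Groups and Number Theory* (1994), §2.3.
* [Omeara1963] O. T. O'Meara, *Introduction to Quadratic Forms* (1963), §63B Prop. 63:13 (local norm index two).
-/

set_option autoImplicit false
set_option linter.dupNamespace false

noncomputable section

open NumberField IsDedekindDomain Matrix
open Literature.NumberTheory.Automorphic Literature.NumberTheory.Automorphic.UnitaryGroup Literature.NumberTheory.Rogawski1990
open Literature.NumberTheory.Weil1982.UnitaryFinTopForm
open Summit.HodgeConjecture.HodgeConjecture.Cruxes.H413.K2E3DockBlockModelRamified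
open scoped MatrixGroups Matrix

namespace Summit.HodgeConjecture.HodgeConjecture.Cruxes.H413.K2E3DockBlockModelOfNotNorm

/-! ## §1 Block rescaling from an algebraic non-norm -/

section Place

variable (L : Type) [Field L] [NumberField L] [IsCMField L] (v : HeightOneSpectrum (𝓞 ↥(maximalRealSubfield L)))
  (w : PlacesOver L v) (hw : IsCMField.complexConj L • w.1 = w.1)
  {ξ₀ : L} (hξc : IsCMField.complexConj L ξ₀ = ξ₀) (hξ0 : ξ₀ ≠ 0)
  (hξnn : ¬ ∃ z : LocalRing L v, IsUnit z ∧ algebraMap L (LocalRing L v) ξ₀ = conjLocal L (IsCMField.complexConj L) v z * z)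

include hw hξc hξ0 hξnn in
/-- **BLOCK RESCALING BY NORM INDEX TWO (algebraic currency).**  For a `σ`-fixed unit `g` of `L ⊗ L⁺_v` (`v` non-split) and a global `ξ₀ ∈ L⁺ ∖ 0` with `ι(ξ₀) ∉ {σ(z)·z}`:
a unit `s` and a GLOBAL `c ∈ {1, ξ₀}` with `σ(s)·g·s = ι(c)` (`g = N(z)` ⇒ `c = 1`; else ★ `exists_norm_mul_of_not_exists_norm` ⇒ `g = N(z)·ι(ξ₀)`, `c = ξ₀`; `s := z⁻¹`).
[cite: Rogawski1990, §3.5 Prop. 3.5.2 (a) p. 29] [cite: Omeara1963, §63B Prop. 63:13] -/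
theorem exists_rescale_of_not_norm {g : LocalRing L v} (hgσ : conjLocal L (IsCMField.complexConj L) v g = g) (hgu : IsUnit g) :
    ∃ (s : LocalRing L v) (c : L), IsUnit s ∧ IsCMField.complexConj L c = c ∧ c ≠ 0 ∧ (c = 1 ∨ c = ξ₀) ∧
      algebraMap L (LocalRing L v) c = conjLocal L (IsCMField.complexConj L) v s * g * s := by
  classical
  haveI : Algebra.IsQuadraticExtension ↥(maximalRealSubfield L) L := IsCMField.isQuadraticExtension L
  set σ := conjLocal L (IsCMField.complexConj L) v with hσdef
  -- an anti-fixed non-zero `δ ∈ L` (the currency of ★ `exists_norm_mul_of_not_exists_norm`)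
  obtain ⟨δ, hcδ, hδ⟩ : ∃ d : L, IsCMField.complexConj L d = -d ∧ d ≠ 0 := by
    have hne : IsCMField.complexConj L ≠ 1 := IsCMField.complexConj_ne_one L
    obtain ⟨t, ht⟩ : ∃ t : L, IsCMField.complexConj L t ≠ t := by
      by_contra hall
      exact hne (AlgEquiv.ext fun t => not_not.mp (not_exists.mp hall t))
    refine ⟨t - IsCMField.complexConj L t, ?_, sub_ne_zero.2 (Ne.symm ht)⟩
    rw [map_sub, IsCMField.complexConj_apply_apply, neg_sub]
  by_cases hg : ∃ z : LocalRing L v, IsUnit z ∧ g = σ z * z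
  · obtain ⟨z, hzu, hz⟩ := hg
    refine ⟨↑(hzu.unit⁻¹), 1, (hzu.unit⁻¹).isUnit, map_one _, one_ne_zero, Or.inl rfl, ?_⟩
    have h3 : z * ↑(hzu.unit⁻¹) = 1 := hzu.mul_val_inv
    have h4 : σ z * σ ↑(hzu.unit⁻¹) = 1 := by rw [← map_mul, h3, map_one]
    rw [map_one, hz]
    have e : σ ↑(hzu.unit⁻¹) * (σ z * z) * ↑(hzu.unit⁻¹) = (σ z * σ ↑(hzu.unit⁻¹)) * (z * ↑(hzu.unit⁻¹)) := by ring
    rw [e, h3, h4, mul_one]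
  · have hξσ : σ (algebraMap L (LocalRing L v) ξ₀) = algebraMap L (LocalRing L v) ξ₀ := by
      rw [hσdef, Literature.NumberTheory.Rogawski1990.conjLocal_algebraMap, hξc]
    have hξu : IsUnit (algebraMap L (LocalRing L v) ξ₀) := (IsUnit.mk0 ξ₀ hξ0).map _
    obtain ⟨z, hzu, hz⟩ := exists_norm_mul_of_not_exists_norm L v (IsCMField.complexConj L) hcδ hδ w hw hξσ hξu hgσ hgu hξnn hg
    refine ⟨↑(hzu.unit⁻¹), ξ₀, (hzu.unit⁻¹).isUnit, hξc, hξ0, Or.inr rfl, ?_⟩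
    have h3 : z * ↑(hzu.unit⁻¹) = 1 := hzu.mul_val_inv
    have h4 : σ z * σ ↑(hzu.unit⁻¹) = 1 := by rw [← map_mul, h3, map_one]
    rw [hz]
    have e : σ ↑(hzu.unit⁻¹) * (σ z * z * algebraMap L (LocalRing L v) ξ₀) * ↑(hzu.unit⁻¹) =
        algebraMap L (LocalRing L v) ξ₀ * ((σ z * σ ↑(hzu.unit⁻¹)) * (z * ↑(hzu.unit⁻¹))) := by ring
    rw [e, h3, h4, mul_one, mul_one]

end Place

/-! ## §2 The dock block model from a global non-norm (any non-split place) -/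

section Dock

/-- **DOCK BLOCK MODEL FROM A GLOBAL NON-NORM (place-generic (D-a)).**  The (D-a) ∕ (D-a-ram) head with the non-norm input in ALGEBRAIC currency: `ξ₀ ∈ L⁺`, `ξ₀ ≠ 0`, whose
image `ι(ξ₀) ∈ L ⊗ L⁺_v` is not of the form `(c ⊗ 1)(z)·z` with `z` a unit (`hξnn`, the currency of ★ `exists_norm_mul_of_not_exists_norm`).  At ANY non-split `v` (`c • w = w`):
from the central point `ε_H = (a·1₂, u)` (`ha`, `u ≠ a`) and a central dock `θ : H_v ≃ₜ* Z(ε)` with `θ ε_H = ε`, `↑(θ z) = y·ι_v(z)·y⁻¹` — GLOBAL `c₂, c₁ ∈ {1, ξ₀}` (non-zero,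
`complexConj`-fixed), a congruence `T` of scalar `1` from `H′_v` to `(c₂Φ₂ ⊕ᶠ c₁Φ₁)_v`, the block-scalar point `x = φ_T⁻¹ ε` (`mat x = a·1₂ ⊕ᶠ u·1₁`, `a − u` a unit, `φ_T x = ε`)
and the intertwining `mat g = z.1 ⊕ᶠ z.2 → φ_T g = ↑(θ z)`.  Specialisations: inert `ξ₀ := ϖ_v` (★ kit `exists_global_uniformizer` + ★ R3g `not_exists_uniformizer_eq_norm` ⇒ (D-a));
tame ramified `ξ₀` := the global unit non-norm (★ `exists_global_unit_not_norm_localRing`, or `exists_blockModel_dock_ramified` directly); WILD ramified `ξ₀` from a wild norm kit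
(K2E3-p03 (g3)'s (J3d-w) census: `exists_blockModel_dock_wild`). [cite: Rogawski1990, §4.8 Case (a) p. 53; §8.1 p. 116; §3.5 Prop. 3.5.2 (a) p. 29] [cite: PlatonovRapinchuk1994, §2.3]
[cite: Omeara1963, §63B Prop. 63:13] -/
theorem exists_blockModel_dock_of_not_norm (L : Type) [Field L] [NumberField L] [IsCMField L] (H' : Matrix (Fin 3) (Fin 3) L)
    (hherm : (H'.map (cmConjRingHom L))ᵀ = H') (hanis : ∀ x : Fin 3 → L, Literature.AlgebraicGeometry.ShimuraVarieties.hermForm (cmConjRingHom L) H' x x = 0 → x = 0)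
    (v : HeightOneSpectrum (𝓞 ↥(maximalRealSubfield L))) (w : PlacesOver L v) (hw : IsCMField.complexConj L • w.1 = w.1)
    (ξ₀ : L) (hξc : IsCMField.complexConj L ξ₀ = ξ₀) (hξ0 : ξ₀ ≠ 0)
    (hξnn : ¬ ∃ z : LocalRing L v, IsUnit z ∧ algebraMap L (LocalRing L v) ξ₀ = conjLocal L (IsCMField.complexConj L) v z * z)
    (εH : ((cmDatum L 2 (Matrix.of fun i j : Fin 2 => if i.val + j.val + 1 = 2 then (1 : L) else 0)).Local v ×
      (cmDatum L 1 (Matrix.of fun i j : Fin 1 => if i.val + j.val + 1 = 1 then (1 : L) else 0)).Local v)) (a : LocalRing L v)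
    (ha : (εH.1.val.val : Matrix (Fin 2) (Fin 2) (LocalRing L v)) = a • (1 : Matrix (Fin 2) (Fin 2) (LocalRing L v)))
    (hu : (εH.2.val.val : Matrix (Fin 1) (Fin 1) (LocalRing L v)) 0 0 ≠ a)
    {ε : (cmDatum L 3 H').Local v} {y : GL (Fin 3) (LocalRing L v)}
    (θ : ((cmDatum L 2 (Matrix.of fun i j : Fin 2 => if i.val + j.val + 1 = 2 then (1 : L) else 0)).Local v ×
      (cmDatum L 1 (Matrix.of fun i j : Fin 1 => if i.val + j.val + 1 = 1 then (1 : L) else 0)).Local v) ≃ₜ* ↥(Subgroup.centralizer ({ε} : Set ((cmDatum L 3 H').Local v))))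
    (hε : (θ εH).1 = ε)
    (hθ : ∀ z : ((cmDatum L 2 (Matrix.of fun i j : Fin 2 => if i.val + j.val + 1 = 2 then (1 : L) else 0)).Local v ×
      (cmDatum L 1 (Matrix.of fun i j : Fin 1 => if i.val + j.val + 1 = 1 then (1 : L) else 0)).Local v),
      (((θ z).1).val : GL (Fin 3) (LocalRing L v)) = y * ((endoEmbLocal L v z).val : GL (Fin 3) (LocalRing L v)) * y⁻¹) :
    ∃ (c₂ c₁ : L), c₂ ≠ 0 ∧ c₁ ≠ 0 ∧ IsCMField.complexConj L c₂ = c₂ ∧ IsCMField.complexConj L c₁ = c₁ ∧ (c₂ = 1 ∨ c₂ = ξ₀) ∧ (c₁ = 1 ∨ c₁ = ξ₀) ∧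
      ∃ (T : GL (Fin (2 + 1)) (LocalRing L v))
        (hT : formCongr (conjLocal L (IsCMField.complexConj L) v) T (H'.map (algebraMap L (LocalRing L v))) =
          (1 : LocalRing L v) • (finSum 2 1 (c₂ • (Matrix.of fun i j : Fin 2 => if i.val + j.val + 1 = 2 then (1 : L) else 0))
            (c₁ • (Matrix.of fun i j : Fin 1 => if i.val + j.val + 1 = 1 then (1 : L) else 0))).map (algebraMap L (LocalRing L v)))
        (x : (cmDatum L (2 + 1) (finSum 2 1 (c₂ • (Matrix.of fun i j : Fin 2 => if i.val + j.val + 1 = 2 then (1 : L) else 0))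
            (c₁ • (Matrix.of fun i j : Fin 1 => if i.val + j.val + 1 = 1 then (1 : L) else 0)))).Local v),
        IsUnit (a - (εH.2.val.val : Matrix (Fin 1) (Fin 1) (LocalRing L v)) 0 0) ∧
        mat L (2 + 1) (finSum 2 1 (c₂ • (Matrix.of fun i j : Fin 2 => if i.val + j.val + 1 = 2 then (1 : L) else 0))
            (c₁ • (Matrix.of fun i j : Fin 1 => if i.val + j.val + 1 = 1 then (1 : L) else 0))) v x =
          finSum 2 1 (a • (1 : Matrix (Fin 2) (Fin 2) (LocalRing L v)))
            (((εH.2.val.val : Matrix (Fin 1) (Fin 1) (LocalRing L v)) 0 0) • (1 : Matrix (Fin 1) (Fin 1) (LocalRing L v))) ∧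
        cmDatumLocalCongr L v T isUnit_one hT x = ε ∧
        ∀ (z : ((cmDatum L 2 (Matrix.of fun i j : Fin 2 => if i.val + j.val + 1 = 2 then (1 : L) else 0)).Local v ×
            (cmDatum L 1 (Matrix.of fun i j : Fin 1 => if i.val + j.val + 1 = 1 then (1 : L) else 0)).Local v))
          (g : (cmDatum L (2 + 1) (finSum 2 1 (c₂ • (Matrix.of fun i j : Fin 2 => if i.val + j.val + 1 = 2 then (1 : L) else 0))
            (c₁ • (Matrix.of fun i j : Fin 1 => if i.val + j.val + 1 = 1 then (1 : L) else 0)))).Local v),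
          mat L (2 + 1) (finSum 2 1 (c₂ • (Matrix.of fun i j : Fin 2 => if i.val + j.val + 1 = 2 then (1 : L) else 0))
              (c₁ • (Matrix.of fun i j : Fin 1 => if i.val + j.val + 1 = 1 then (1 : L) else 0))) v g =
            finSum 2 1 (z.1.val.val : Matrix (Fin 2) (Fin 2) (LocalRing L v)) (z.2.val.val : Matrix (Fin 1) (Fin 1) (LocalRing L v)) →
          cmDatumLocalCongr L v T isUnit_one hT g = ((θ z).1 : (cmDatum L 3 H').Local v) := by
  classical
  haveI : Algebra.IsQuadraticExtension ↥(maximalRealSubfield L) L := IsCMField.isQuadraticExtension L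
  set σ := conjLocal L (IsCMField.complexConj L) v with hσdef
  -- (1) F3a: `ᵗ(σy)·H′_v·y = (0 0 λ; 0 μ 0; λ 0 0)`, `σλ = λ`, `σμ = μ`
  obtain ⟨lam, mu, hlam, hmu, hyG⟩ :=
    K2E3DockInvariantForm.exists_formCongr_dock_eq L H' v hherm θ (fun t => (t : (cmDatum L 3 H').Local v)) y hθ
  have hHv : (adelicForm L 3 H').map (adeleToLocal L v) = H'.map (algebraMap L (LocalRing L v)) :=
    Literature.NumberTheory.Rogawski1990.adelicForm_map_adeleToLocal L v H'
  rw [hHv] at hyG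
  -- (2) `λ, μ` are units (`det H′ ≠ 0`)
  have hdet' : H'.det ≠ 0 := Godement.det_ne_zero_of_anisotropic L H' hanis
  have hHvd : IsUnit (H'.map (algebraMap L (LocalRing L v))).det := by
    rw [← hHv]; exact UnitaryGroup.isUnit_det_localForm L 3 H' v hdet'
  have hGd : IsUnit (formCongr σ y (H'.map (algebraMap L (LocalRing L v)))).det := isUnit_det_formCongr σ y hHvd
  rw [hyG] at hGd
  obtain ⟨hlu, hmuu⟩ := isUnit_dockForm_entries hGd
  -- (3) block rescaling by norm index two: `σ(s₂)λs₂ = ι c₂`, `σ(s₁)μs₁ = ι c₁`, `cᵢ ∈ {1, ξ₀}`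
  obtain ⟨s₂, c₂, hs₂, hc₂c, hc₂0, hc₂m, hc₂loc⟩ := exists_rescale_of_not_norm L v w hw hξc hξ0 hξnn hlam hlu
  obtain ⟨s₁, c₁, hs₁, hc₁c, hc₁0, hc₁m, hc₁loc⟩ := exists_rescale_of_not_norm L v w hw hξc hξ0 hξnn hmu hmuu
  obtain ⟨t₂, ht₂⟩ := hs₂.exists_right_inv
  obtain ⟨t₁, ht₁⟩ := hs₁.exists_right_inv
  -- the rescaling unit `M = ι(s₂·1₂, s₁)·W`
  obtain ⟨M, hM, hMi⟩ : ∃ M : GL (Fin 3) (LocalRing L v), M.val = !![s₂, 0, 0; 0, 0, s₁; 0, s₂, 0] ∧ (M⁻¹).val = !![t₂, 0, 0; 0, 0, t₂; 0, t₁, 0] :=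
    ⟨⟨_, _, rescale_mul_rescaleInv ht₂ ht₁, rescaleInv_mul_rescale ht₂ ht₁⟩, rfl, rfl⟩
  -- (4) the congruence `T := y·M` of scalar `1` onto `(c₂Φ₂ ⊕ᶠ c₁Φ₁)_v`
  obtain ⟨hB, hC⟩ := map_smul_antidiagOne_two_one L v c₂ c₁
  have hT : formCongr σ (y * M) (H'.map (algebraMap L (LocalRing L v))) =
      (1 : LocalRing L v) • (finSum 2 1 (c₂ • (Matrix.of fun i j : Fin 2 => if i.val + j.val + 1 = 2 then (1 : L) else 0))
        (c₁ • (Matrix.of fun i j : Fin 1 => if i.val + j.val + 1 = 1 then (1 : L) else 0))).map (algebraMap L (LocalRing L v)) := by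
    rw [K2E3DockBlockModelRamified.formCongr_mul_eq, hyG, one_smul, finSum_map, hB, hC, finSum_antidiag_two_one, hM, transpose_map_rescale_mul_dockForm_mul_rescale σ s₂ s₁ lam mu,
      ← hc₂loc, ← hc₁loc]
  -- (5) the block-scalar preimage `x := φ_T⁻¹ ε`
  set φ := cmDatumLocalCongr L v (y * M) isUnit_one hT with hφdef
  have hεv : (ε.val : GL (Fin 3) (LocalRing L v)) = y * ((endoEmbLocal L v εH).val : GL (Fin 3) (LocalRing L v)) * y⁻¹ := by
    rw [← hε]; exact hθ εH
  have hconj : (y * M) * (φ.symm ε).val * (y * M)⁻¹ = ε.val := by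
    rw [← coe_cmDatumLocalCongr_apply L v (y * M) isUnit_one hT (φ.symm ε)]
    exact congrArg Subtype.val (φ.apply_symm_apply ε)
  have hx1 := eq_conj_of_frame_conj_eq hconj hεv
  have hιε : ((((endoEmbLocal L v εH).val : GL (Fin 3) (LocalRing L v))).val : Matrix (Fin 3) (Fin 3) (LocalRing L v)) =
      !![a, 0, 0; 0, (εH.2.val.val : Matrix (Fin 1) (Fin 1) (LocalRing L v)) 0 0, 0; 0, 0, a] :=
    coe_coe_endoEmbLocal_of_fst_eq_smul_one L v εH a ha
  have hxmat : mat L (2 + 1) (finSum 2 1 (c₂ • (Matrix.of fun i j : Fin 2 => if i.val + j.val + 1 = 2 then (1 : L) else 0))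
      (c₁ • (Matrix.of fun i j : Fin 1 => if i.val + j.val + 1 = 1 then (1 : L) else 0))) v (φ.symm ε) =
      finSum 2 1 (a • (1 : Matrix (Fin 2) (Fin 2) (LocalRing L v)))
        (((εH.2.val.val : Matrix (Fin 1) (Fin 1) (LocalRing L v)) 0 0) • (1 : Matrix (Fin 1) (Fin 1) (LocalRing L v))) := by
    rw [mat_def, hx1, Units.val_mul, Units.val_mul, hMi, hM, hιε, finSum_smul_one_smul_one]
    exact rescaleInv_mul_diagonal_mul_rescale ht₂ ht₁ a _
  -- (6) assemble; the intertwining `φ_T g = ↑(θ z)` for `mat g = z.1 ⊕ᶠ z.2`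
  refine ⟨c₂, c₁, hc₂0, hc₁0, hc₂c, hc₁c, hc₂m, hc₁m, y * M, hT, φ.symm ε, isUnit_sub_of_ne_of_smul_eq L v w hw hu, hxmat, φ.apply_symm_apply ε, ?_⟩
  intro z g hg
  apply Subtype.ext
  have hgm : (((g.val : GL (Fin 3) (LocalRing L v))).val : Matrix (Fin 3) (Fin 3) (LocalRing L v)) =
      finSum 2 1 (z.1.val.val : Matrix (Fin 2) (Fin 2) (LocalRing L v)) (z.2.val.val : Matrix (Fin 1) (Fin 1) (LocalRing L v)) := hg
  have hMg : M * (g.val : GL (Fin 3) (LocalRing L v)) * M⁻¹ = ((endoEmbLocal L v z).val : GL (Fin 3) (LocalRing L v)) := by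
    apply Units.ext
    rw [Units.val_mul, Units.val_mul, hM, hMi, hgm, coe_endoEmbLocal, coe_endoGL_eq]
    exact rescale_mul_finSum_mul_rescaleInv ht₂ ht₁ _ _
  have hφg : ((φ g).val : GL (Fin 3) (LocalRing L v)) = (y * M) * (g.val : GL (Fin 3) (LocalRing L v)) * (y * M)⁻¹ :=
    coe_cmDatumLocalCongr_apply L v (y * M) isUnit_one hT g
  rw [hφg, frame_mul_conj_eq y M (g.val : GL (Fin 3) (LocalRing L v)), hMg, hθ z]

end Dock

end Summit.HodgeConjecture.HodgeConjecture.Cruxes.H413.K2E3DockBlockModelOfNotNorm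

end
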